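import Literature.NumberTheory.Automorphic.LanglandsTunnell
import Literature.NumberTheory.GaloisRepresentations.ArtinLFunctionProofs
import HarnessLib

/-!
# Deligne–Serre, Thm. 4.6 (a): the Artin conductor of `ρ_f` is the level
(decomposition of `Literature.NumberTheory.Automorphic.artinConductorNat_eq_level`)

D-0014 keeps `Literature/` sorry-free by stating cited results as named facts `def X : Prop`.
The named fact `Literature.NumberTheory.Automorphic.artinConductorNat_eq_level` of
`Literature.NumberTheory.Automorphic.LanglandsTunnell` says: if a continuous representation
`ρ : Γ_ℚ → GL₂(ℂ)` (`Literature.FramedArtinRep ℚ 2`, `ℂ` with its usual topology) is attached away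
from `N` to a weight-one newform `f ∈ S₁(Γ₁(N))` (`IsGaloisRepOfNewform1`: unramified at every
prime `p ∤ N`, with `charpoly ρ(Frob_p) = X² − a_p X + ε(p)` for the arithmetic Frobenius),
then the numerical Artin conductor of `ρ` (`GaloisRep.artinConductorNat`, item C10) is `N`.

Its source is Deligne–Serre, *Formes modulaires de poids 1*, Ann. Sci. ÉNS (4) 7 (1974),
Thm. 4.6 (a), p. 514: "Supposons `f` parabolique primitive, de coefficients `a_n`, `n ≥ 1`.
Soit `ρ` la représentation de `G` correspondante. Alors : a. Le conducteur d'Artin de `ρ` est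
égal à `N`", where "la représentation correspondante" is the representation of Thm. 4.1
(`G → GL₂(ℂ)`, `ℂ` *with the discrete topology*, §3 (a): "l'image de `ρ` est finie"),
unique up to isomorphism by Rem. 4.3 (Lemma 3.2: Chebotarev density and Brauer–Nesbitt;
Rem. 3.4: over `ℂ` semisimplicity is automatic since the images are finite).

## This file: the top layer

* `Literature.NumberTheory.Automorphic.ModularForms.DeligneSerre1974.thm46a_artinConductorNat_eq` — **Thm. 4.6 (a) with
  Rem. 4.3**, in the source's own setting (finite image): every finite-image representation
  `ρ : Γ_ℚ → GL₂(ℂ)` attached to the weight-one newform `f` away from `N` has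
  `artinConductorNat ρ = N`.  Named fact, same carriers as the sibling constituents
  `thm41_exists`, `thm41_isIrreducible`, `rem45_isOdd` of
  `Literature.NumberTheory.EllipticCurves.NewformGaloisRepProofs`.
* `Literature.NumberTheory.GaloisRepresentations.FramedRep.finite_range_toContinuousRep_iff` — a framed representation
  `G →ₜ* GL_n(A)` has finite image iff the associated continuous representation on column
  vectors `Fin n → A` takes finitely many values (the standard representation of `GL_n(A)` is
  faithful).  Proved.
* `Literature.NumberTheory.Automorphic.artinConductorNat_eq_level_of` — **assembly**, proved:
  `thm46a_artinConductorNat_eq → artinConductorNat_eq_level`; the finite-image hypothesis of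
  the source is discharged by the theorem `ArtinRep.finite_range_holds`
  (`Literature.NumberTheory.GaloisRepresentations.ArtinLFunctionProofs`: an Artin
  representation on `ℂⁿ` with its module topology has open kernel, `Γ_ℚ` being profinite and
  `GL_n(ℂ)` having no small subgroups, hence finite image).

## The printed proof of Thm. 4.6 (op. cit. pp. 515–516): the lower layers

None of the following is in Mathlib; they are the lower named facts of this decomposition,
vendored and proved bottom-up in sibling files (fact-owner's NOTES; e.g. Lemma 4.9 is
stated *and proved* in `Literature/NumberTheory/LFunctions/FiniteEulerProducts.lean`, the
`f`-side inputs (1.7.2), 1.8, (i) are stated in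
`Literature/NumberTheory/EllipticCurves/Gamma1NewformLSeries.lean`), after which
`thm46a_artinConductorNat_eq` is to be assembled from them:

1. (i) For `f = Σ a_n qⁿ` primitive of type `(1, ε)` on `Γ₀(N)` there is `λ ≠ 0` with
   `f(−1/Nz) = λ z f̃(z)`, `f̃ = Σ ā_n qⁿ` (Hecke; Li 1975), whence by Mellin transform
   `Λ_f(1 − s) = a Λ_{f̃}(s)`, `Λ_f(s) = N^{s/2} (2π)^{−s} Γ(s) Φ_f(s)`, `Φ_f(s) = Σ a_n n^{−s}`
   (the tree has `W_N` only on `Γ₀(N)` with trivial character: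
   `Literature.NumberTheory.EllipticCurves.ModularForms.frickeInvolution`).
2. (ii) Artin's functional equation `ζ(1 − s, ρ) = v ζ(s, ρ̄)` for
   `ζ(s, ρ) = M^{s/2} (2π)^{−s} Γ(s) L(s, ρ)`, `M` the Artin conductor of `ρ`, the factor at
   infinity being `(2π)^{−s} Γ(s)` because `ρ` is odd (Rem. 4.5).  In the tree:
   `Literature.NumberTheory.Automorphic.artin_functional_equation` (named fact, `Λ(1 − s, ρ) = W Λ(s, ρ^∨)` with
   `ArtinRep.artinConductorNorm ρ = |d_ℚ|² · artinConductorNat ρ = M` and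
   `ArtinRep.gammaFactor ρ s = Γ_ℝ(s) Γ_ℝ(s + 1) = 2 (2π)^{−s} Γ(s)` for signature `(1, 1)`).
3. (iii) By (4.1.1) the Euler factors of `Φ_f` and of `L(s, ρ)` agree at every `p ∤ N`, so
   `F(s) = (N/M)^{s/2} Λ_f(s) / ζ(s, ρ) = A^s ∏_{p ∣ N} F_p(s)`, `A = (N/M)^{1/2}`,
   `F_p(s) = (1 − b_p p^{−s})(1 − c_p p^{−s})/(1 − a_p p^{−s})`, is a *finite* Euler product
   with `F(1 − s) = ω F̃(s)` (needs the Euler product of `Φ_f` for a `Γ₁(N)`-newform — the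
   tree has only `IsNewform0.hasProd_cuspFormLSeries` — and `artinLFunction_eulerProduct`).
4. (iv) **Lemma 4.9**: if `G(s) = A^s ∏_p G_p(s)` and `H(s) = A^s ∏_p H_p(s)` are finite Euler
   products, each `G_p`, `H_p` a finite product of terms `(1 − α p^{−s})^{±1}` with
   `|α| < p^{1/2}`, and `G(1 − s) = ω H(s)` with `ω ∈ ℂ*`, then `A = 1` and `G_p = H_p = 1`
   for all `p`.  Applied with `|a_p| ≤ 1` for `p ∣ N` ((1.8), or Rankin's estimate) and
   `b_p, c_p` roots of unity or `0`, it gives `A = 1`, i.e. `M = N` (and Thm. 4.6 (b)).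

## References

* P. Deligne, J.-P. Serre, *Formes modulaires de poids 1*, Ann. Sci. ÉNS (4) 7 (1974),
  507–530, doi:10.24033/asens.1277 — §3 (a), Lemma 3.2, Rem. 3.4, Thm. 4.1, Rem. 4.3,
  Thm. 4.6, Lemma 4.9 (`DeligneSerreASENS1974`).
* J.-P. Serre, *Abelian ℓ-adic representations and elliptic curves* (1968), Ch. I §1.1,
  Remark (finite image of continuous complex representations) (`SerreAbelianLadic1968`).
-/

noncomputable section

open scoped MatrixGroups ModularForm NumberField

open CongruenceSubgroup

namespace Literature.NumberTheory.Automorphic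

/-! ### Finite image: framed representation vs. representation on column vectors -/

section FramedRep
open Literature.NumberTheory.GaloisRepresentations (FramedRep)
open Literature.NumberTheory.GaloisRepresentations.FramedRep

variable {G : Type*} [Group G] [TopologicalSpace G] {A : Type*} [CommRing A]
  [TopologicalSpace A] [IsTopologicalRing A] {n : ℕ}

/-- The representation on column vectors underlying a framed representation is the composite of
`ρ` with the (faithful) standard representation `g ↦ (v ↦ g *ᵥ v)` of `GL_n(A)`
(Mathlib `Matrix.toLin'`). [folklore] -/
theorem _root_.Literature.NumberTheory.GaloisRepresentations.FramedRep.coe_toContinuousRep_eq_comp (ρ : FramedRep G A n) :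
    (ρ.toContinuousRep : G → (Fin n → A) →ₗ[A] (Fin n → A)) =
      (fun g : GL (Fin n) A => Matrix.toLin' (g : Matrix (Fin n) (Fin n) A)) ∘
        (ρ : G → GL (Fin n) A) := by
  funext g
  refine LinearMap.ext fun v => ?_
  simp only [Function.comp_apply, Matrix.toLin'_apply, toContinuousRep_apply_apply]

/-- A framed representation `ρ : G →ₜ* GL_n(A)` has **finite image** iff the associated
continuous representation on column vectors `Fin n → A` (`FramedRep.toContinuousRep`) takes
finitely many values: the standard representation of `GL_n(A)` on `Aⁿ` is faithful
(`Matrix.toLin'` is injective).  Used to feed the finite-image hypothesis of Deligne–Serre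
(`ℂ` discrete) from `ArtinRep.finite_range` (`ℂ` with its usual topology). [folklore] -/
theorem _root_.Literature.NumberTheory.GaloisRepresentations.FramedRep.finite_range_toContinuousRep_iff (ρ : FramedRep G A n) :
    (Set.range (ρ.toContinuousRep : G → (Fin n → A) →ₗ[A] (Fin n → A))).Finite ↔
      (Set.range (ρ : G → GL (Fin n) A)).Finite := by
  have hinj : Function.Injective
      (fun g : GL (Fin n) A => Matrix.toLin' (g : Matrix (Fin n) (Fin n) A)) :=
    fun g h hgh => Units.ext (Matrix.toLin'.injective hgh)
  rw [coe_toContinuousRep_eq_comp, Set.range_comp]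
  exact ⟨fun h => h.of_finite_image hinj.injOn, fun h => h.image _⟩

end FramedRep

/-! ### Deligne–Serre 1974, Thm. 4.6 (a) (finite-image form) -/

namespace ModularForms

variable {N : ℕ} [NeZero N]

namespace DeligneSerre1974

/-- **Deligne–Serre 1974, Thm. 4.6 (a) with Rem. 4.3.**  Let `f = Σ a_n qⁿ ∈ S₁(Γ₁(N))` be a
newform of weight one ("parabolique primitive de type `(1, ε)` sur `Γ₀(N)`", `ε` its
nebentypus) and let `ρ : Gal(ℚ̄/ℚ) → GL₂(ℂ)` be a representation with finite image (`ℂ` with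
the discrete topology, §3 (a)) attached to `f` away from `N`: unramified at every `p ∤ N` with
`Tr(F_p) = a_p`, `det(F_p) = ε(p)` (4.1.1), i.e. `charpoly ρ(F_p) = X² − a_p X + ε(p)`
(`IsGaloisRepOfNewform1 f ι {p ∣ N} ρ`, arithmetic Frobenius).  Then the Artin conductor of
`ρ` is `N` (`GaloisRep.artinConductorNat`, the positive generator of `𝔣(ρ) ⊆ ℤ`).  In the
source this is stated for "la représentation correspondante" of Thm. 4.1; by Rem. 4.3
(Lemma 3.2 with Rem. 3.4) any finite-image `ρ` attached to `f` away from `N` is isomorphic to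
it, and the Artin conductor is an isomorphism invariant.  Proof: op. cit. pp. 515–516, from
the functional equations of `Λ_f` and of `L(s, ρ)` and Lemma 4.9 (see the module docstring).
[cite: DeligneSerreASENS1974, Thm. 4.6 (a) and Rem. 4.3] -/
def thm46a_artinConductorNat_eq : Prop :=
  ∀ {f : CuspForm (Gamma1 N) 1} (_hf : EllipticCurves.ModularForms.IsNewform1 f) (ρ : GaloisRepresentations.FramedGaloisRep ℚ ℂ 2),
    EllipticCurves.ModularForms.IsGaloisRepOfNewform1 f (algebraMap (EllipticCurves.ModularForms.coeffCharField f) ℂ) {p | p ∣ N} ρ →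
      (Set.range ρ).Finite → GaloisRepresentations.GaloisRep.artinConductorNat ρ.toGaloisRep = N

end DeligneSerre1974

end ModularForms

/-! ### Assembly of `artinConductorNat_eq_level` -/

section Lang

open EllipticCurves.ModularForms ModularForms.DeligneSerre1974

variable {N : ℕ} [NeZero N] {f : CuspForm (Gamma1 N) 1} {ρ : GaloisRepresentations.FramedArtinRep ℚ 2}

/-- **Assembly of `artinConductorNat_eq_level`** from Deligne–Serre, Thm. 4.6 (a) (with
Rem. 4.3) in its printed finite-image form (`thm46a_artinConductorNat_eq`, threaded as a
hypothesis, D-0014): a continuous `ρ : Γ_ℚ → GL₂(ℂ)` (`ℂ` with its usual topology) has finite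
image by `ArtinRep.finite_range_holds` (open kernel: `Γ_ℚ` is profinite and `GL₂(ℂ)` has no
small subgroups; Serre, *Abelian ℓ-adic representations* (1968), Ch. I §1.1, Remark),
transported to the framed representation by `FramedRep.finite_range_toContinuousRep_iff`.
[cite: DeligneSerreASENS1974, Thm. 4.6 (a) and Rem. 4.3]
[cite: SerreAbelianLadic1968, Ch. I §1.1 Remark] -/
theorem artinConductorNat_eq_level_of (h46 : thm46a_artinConductorNat_eq (N := N)) :
    artinConductorNat_eq_level (f := f) (ρ := ρ) := by
  intro hf hρ
  have hfin : (Set.range (ρ : Field.absoluteGaloisGroup ℚ → GL (Fin 2) ℂ)).Finite :=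
    (GaloisRepresentations.FramedRep.finite_range_toContinuousRep_iff ρ).mp
      (GaloisRepresentations.ArtinRep.finite_range_holds (K := ℚ) (V := Fin 2 → ℂ) ρ.toArtinRep)
  exact h46 hf ρ hρ hfin

end Lang

end Literature.NumberTheory.Automorphic
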